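import Summits.QuantumFields.YangMills.Theorems.BalabanUVNodesN15CovariantLandauLetterFromFlat
import Summits.QuantumFields.YangMills.Theorems.BalabanUVNodesN15TwoSpacingGluingCurvedKnitCovariantAveragingTransfer
import Summits.QuantumFields.YangMills.Theorems.BalabanUVNodesN15CovariantLandauMass
import Summits.QuantumFields.YangMills.Theorems.BalabanUVNodesN15TwoSpacingGluingCurvedKnitCovariantAveragingNode
import HarnessLib

/-!
# Route «BalabanUVNodes», node N15 = NE2, road (c) — PROGRAMME (P-S), VIII: THE GLOBAL ROW OF THE LANDAU PERTURBATION LETTER FOR THE TRANSPORTERS `Ad_{e^{ηA}}` OF A SKEW FIELD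
# `A` OF SIZE `r` — the transporter letters `nρ ≤ C_ρ·r`, `σ ≤ C_σ·r` DISCHARGED from [B9] (3.35)'s field size, the mass of the flat rows fixed at `a = n^{d+1}` (unit averaging weight),
# so that only the FOUR FLAT propagator rows and the ONE covariant gradient-difference row remain as hypotheses (dag-n15-c g23, n15-c∕218)

Cell `pub-ymgap`, seat `pub-ymgap-dag-n15-c` (generation g23; R134 (a), s1; HUMAN RULING D-0062; chair R424 venue).  `bears_on: R4∕N15 · K3⁸ SpineGivenEndpointR13SepCoPHV
(stmt-QuantumFields-27366)`; filed `--supports stmt-QuantumFields-27366 --as helper` — COUNT-NEUTRAL.  One bookkeeping `def` (`landauExpThreshold`) + theorems; 0 `sorry`; NO estimate of Bałaban's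
(flat rows + gradient difference are HYPOTHESES).  Imports BY NAME n15-c∕217 (`hasMaj_landauCov_sub_of_flat`, `landauSmallConst`, `landauRowConst`), n15-c∕187a
(`sf_abs_cvT_exp_sub_one_entry_le`: the entry letter of `coordMat e Ad_{e^{ηA}} − 1`), n15-c∕210 (`isUnit_cvT₀`, `landauCov_eq_of_mass`), n15-c∕182a (`rows∕cols_cvaStair_sub_one_le`), 189b
(`pow_sub_one_le_exp_sub_one`), `CurvedSpecies.exp_smul_unitary_of_conjTranspose`, Literature `exp_sub_one_le_two_mul`.  Nothing in the tree is modified.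

WHY.  n15-c∕217 reduces the global row of `N_V^R` (per grid) to the four flat rows, the gradient difference and the transporter letters `nρ`, `σ` of the datum `T`.  For the knit's data —
`T = cvT₀ e U`, `U = e^{ηA}`, `η = 1/n`, `A` skew with `‖A‖ ≤ r` (the class (3.35) in the cube's own gauge, [Balaban1985BackgroundPropagators] (3.35)–(3.37) p. 396) — the letters ARE
`O(r)`: entry rows of `T − 1` are `≤ |ι|κ_e·2√m·√m·(e^{ηr} − 1) ≤ C_ρ·r∕n` and the staircase differences `(1 + ρ)^{(d+1)n} − 1 ≤ 2(d+1)nρ ≤ C_σ·r` (n15-c∕182a, 187a, 207's arithmetic).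
THIS FILE discharges them, at the mass `a = n^{d+1}` (averaging weight `a·n^{−(d+1)} = 1`, [Balaban1984PropagatorsII] (2.3) «a(L^kη)^{−2}» with `L^kη = 1`), leaving the global row
of `landauCov T n^{d+1} − landauCov 1 n^{d+1}` — by n15-c∕210 the Landau term is mass-free, so this IS the knit's letter — conditional on the flat rows and the gradient difference only.
* §1 `tLetter_rows`, `tLetter_nrho`, `tLetter_sigma`: the transporter letters of `Ad_{e^{A/n}}` (`C_ρ = 4|ι|κ_e·2√m·√m`, `C_σ = 2(d+1)C_ρ`).
* §2 `landauExpThreshold`, ★★★ **`hasMaj_landauCov_sub_exp_of_flat`** (mass `n^{d+1}`), v1.1 ★★★ `hasMaj_landauCov_sub_exp_of_flat_mass` (any mass `a_w·n^{d+1}`, `0 < a_w ≤ 1`) — for `r` below `landauExpThreshold`: `landauCov (cvT₀ e e^{A/n}) n^{d+1} − landauCov 1 n^{d+1} ≤ landauRowConst·r·e^{−(3δ/8)d}`.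

HONEST FRAMING ∕ LIMITS.  Bookkeeping + real arithmetic; the four flat rows ([Balaban1984PropagatorsII] Props. 2.2–2.3 ∕ [B9] Thms 3.1–3.2 at `U ≡ 1`, mass `a = n^{d+1}`) and the covariant
gradient difference ([B9] Thm 3.4) are HYPOTHESES; MODEL READING as n15-c∕197; NOT [Balaban1985BackgroundPropagators] Thms 3.1–3.4 as printed; NE2⁺ NOT PRINTED; N15 of record untouched
(DISCHARGED AS CONSUMED, p687738); counts UNMOVED (typed 28∕28 · discharged 8∕27); one finite 𝕋⁴ at fixed ε per index — NOT infinite volume ∕ OS ∕ mass gap ∕ Clay.  Restate-immune.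
-/

noncomputable section

open scoped BigOperators Matrix

namespace Summit.QuantumFields.YangMills.BalabanUVNodes.N15.Gluing

open Literature.MathematicalPhysics.QuantumFieldTheory.Balaban1983to89
open Literature.MathematicalPhysics.QuantumFieldTheory.Balaban1983to89.B5Prop11Plancherel (Tor fine)
open Literature.MathematicalPhysics.QuantumFieldTheory.Balaban1983to89.B11SectG (BlockNorm HasMaj)
open Literature.MathematicalPhysics.QuantumFieldTheory.Balaban1983to89.B6UnitTorusCarrier (unitTorusGeo unitTorusGeo_dist_nonneg)
open Literature.MathematicalPhysics.QuantumFieldTheory.King1986.Torus (blockOf tdistT)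
open Literature.NumberTheory.Sieve.SquarefreeSums (exp_sub_one_le_two_mul)
open Summit.QuantumFields.YangMills.BalabanUVNodes.N15.MatrixSpecies (liftBlk basisConst basisConst_nonneg)
open Summit.QuantumFields.YangMills.BalabanUVNodes.N15.CovAvg (cvaStair cvaStair_one rows_cvaStair_sub_one_le cols_cvaStair_sub_one_le)
open Summit.QuantumFields.YangMills.BalabanUVNodes.N15.CovLandau (cgrad csavg cGreen cSop landauCov landauSmallConst landauRowConst hasMaj_landauCov_sub_of_flat landauCov_eq_of_mass)
open Summit.QuantumFields.YangMills.BalabanUVNodes.N15.CurvedSpecies (exp_smul_unitary_of_conjTranspose)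

variable {d : ℕ}

section Exp

open scoped Matrix.Norms.L2Operator

variable (M : Fin (d + 1) → ℕ) [∀ μ, NeZero (M μ)] (n : ℕ) [NeZero n] {ι : Type} [Fintype ι] [DecidableEq ι] (L k : ℕ)
  {mm : Type} [Fintype mm] [DecidableEq mm] (e : Matrix mm mm ℂ ≃L[ℝ] (ι → ℝ))

/-! ## §1 The transporter letters of `T = coordMat e Ad_{e^{A/n}}` for a skew field of size `r` -/

/-- ENTRY ROWS AND COLUMNS of `T − 1`, `T = cvT₀ e (e^{A/n})`: `≤ |ι|·κ_e·2√m·(√m·(e^{r/n} − 1))` for skew `A` with `‖A‖ ≤ r`. [cite: Balaban1985BackgroundPropagators, (3.35)–(3.37) p.396, (3.50) p.400 (shapes)] -/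
theorem tLetter_rows {A : Fin (d + 1) → Tor (fine n M) × Fin (d + 1) → Matrix mm mm ℂ} (hAs : ∀ μ p, (A μ p)ᴴ = -A μ p) {r : ℝ} (hA : ∀ μ p, ‖A μ p‖ ≤ r) :
    (∀ ν x i, ∑ j, |((cvT₀ e (fun μ p => NormedSpace.exp ((((n : ℕ) : ℝ))⁻¹ • A μ p))) ν x - (fun (_ : Fin (d + 1)) (_ : Tor (fine n M)) => (1 : Matrix ι ι ℝ)) ν x) i j| ≤
        Fintype.card ι * (@basisConst ι _ (Matrix mm mm ℂ) Matrix.frobeniusNormedAddCommGroup Matrix.frobeniusNormedSpace e * (2 * Real.sqrt (Fintype.card mm)) * (Real.sqrt (Fintype.card mm) * (Real.exp ((((n : ℕ) : ℝ))⁻¹ * r) - 1)))) ∧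
    (∀ ν x j, ∑ i, |((cvT₀ e (fun μ p => NormedSpace.exp ((((n : ℕ) : ℝ))⁻¹ • A μ p))) ν x - (fun (_ : Fin (d + 1)) (_ : Tor (fine n M)) => (1 : Matrix ι ι ℝ)) ν x) i j| ≤
        Fintype.card ι * (@basisConst ι _ (Matrix mm mm ℂ) Matrix.frobeniusNormedAddCommGroup Matrix.frobeniusNormedSpace e * (2 * Real.sqrt (Fintype.card mm)) * (Real.sqrt (Fintype.card mm) * (Real.exp ((((n : ℕ) : ℝ))⁻¹ * r) - 1)))) := by
  have hη : (0 : ℝ) ≤ (((n : ℕ) : ℝ))⁻¹ := by positivity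
  have hent : ∀ ν x i j, |((cvT₀ e (fun μ p => NormedSpace.exp ((((n : ℕ) : ℝ))⁻¹ • A μ p))) ν x - (fun (_ : Fin (d + 1)) (_ : Tor (fine n M)) => (1 : Matrix ι ι ℝ)) ν x) i j| ≤
      @basisConst ι _ (Matrix mm mm ℂ) Matrix.frobeniusNormedAddCommGroup Matrix.frobeniusNormedSpace e * (2 * Real.sqrt (Fintype.card mm)) * (Real.sqrt (Fintype.card mm) * (Real.exp ((((n : ℕ) : ℝ))⁻¹ * r) - 1)) :=
    fun ν x i j => sf_abs_cvT_exp_sub_one_entry_le e hη hAs hA ν (x, ν) i j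
  refine ⟨fun ν x i => ?_, fun ν x j => ?_⟩
  · calc _ ≤ ∑ _j : ι, @basisConst ι _ (Matrix mm mm ℂ) Matrix.frobeniusNormedAddCommGroup Matrix.frobeniusNormedSpace e * (2 * Real.sqrt (Fintype.card mm)) * (Real.sqrt (Fintype.card mm) * (Real.exp ((((n : ℕ) : ℝ))⁻¹ * r) - 1)) :=
          Finset.sum_le_sum fun j _ => hent ν x i j
      _ = _ := by rw [Finset.sum_const, Finset.card_univ, nsmul_eq_mul]
  · calc _ ≤ ∑ _i : ι, @basisConst ι _ (Matrix mm mm ℂ) Matrix.frobeniusNormedAddCommGroup Matrix.frobeniusNormedSpace e * (2 * Real.sqrt (Fintype.card mm)) * (Real.sqrt (Fintype.card mm) * (Real.exp ((((n : ℕ) : ℝ))⁻¹ * r) - 1)) :=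
          Finset.sum_le_sum fun i _ => hent ν x i j
      _ = _ := by rw [Finset.sum_const, Finset.card_univ, nsmul_eq_mul]

omit [∀ μ, NeZero (M μ)] [DecidableEq ι] [Fintype mm] [DecidableEq mm] in
/-- `n·ρ ≤ C_ρ·r`, `C_ρ = 4|ι|κ_e·2√m·√m∕2`: `n(e^{r/n} − 1) ≤ 2r` for `r ≤ 1 ≤ n`. [folklore] -/
theorem tLetter_nrho {r κm : ℝ} (hκm : 0 ≤ κm) (hr0 : 0 ≤ r) (hr1 : r ≤ 1) :
    (n : ℝ) * (Fintype.card ι * (κm * (Real.exp ((((n : ℕ) : ℝ))⁻¹ * r) - 1))) ≤ (2 * Fintype.card ι * κm) * r := by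
  have hn1 : (1 : ℝ) ≤ (n : ℝ) := by exact_mod_cast Nat.one_le_iff_ne_zero.mpr (NeZero.ne n)
  have hn0 : (0 : ℝ) < (n : ℝ) := by linarith
  have hx0 : 0 ≤ (((n : ℕ) : ℝ))⁻¹ * r := by positivity
  have hx1 : (((n : ℕ) : ℝ))⁻¹ * r ≤ 1 := by
    rw [inv_mul_le_iff₀ hn0]; linarith
  have hex := exp_sub_one_le_two_mul hx0 hx1
  calc (n : ℝ) * (Fintype.card ι * (κm * (Real.exp ((((n : ℕ) : ℝ))⁻¹ * r) - 1)))
      ≤ (n : ℝ) * (Fintype.card ι * (κm * (2 * ((((n : ℕ) : ℝ))⁻¹ * r)))) := by gcongr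
    _ = (2 * Fintype.card ι * κm) * r := by field_simp

omit [∀ μ, NeZero (M μ)] [DecidableEq ι] [Fintype mm] [DecidableEq mm] [NeZero n] [Fintype ι] in
/-- `σ ≤ C_σ·r`: `(1 + ρ)^{(d+1)n} − 1 ≤ e^{(d+1)nρ} − 1 ≤ 2(d+1)·nρ ≤ 2(d+1)C_ρ·r` when `(d+1)C_ρr ≤ 1`. [folklore] -/
theorem tLetter_sigma {ρ Cρ r : ℝ} (hρ0 : 0 ≤ ρ) (hnρ : (n : ℝ) * ρ ≤ Cρ * r) (hsmall : ((d : ℝ) + 1) * Cρ * r ≤ 1) :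
    (1 + ρ) ^ ((d + 1) * n) - 1 ≤ (2 * ((d : ℝ) + 1) * Cρ) * r := by
  have h1 := pow_sub_one_le_exp_sub_one hρ0 ((d + 1) * n)
  have hx : ρ * (((d + 1) * n : ℕ) : ℝ) = ((d : ℝ) + 1) * ((n : ℝ) * ρ) := by push_cast; ring
  rw [hx] at h1
  have hy0 : 0 ≤ ((d : ℝ) + 1) * ((n : ℝ) * ρ) := by
    have : 0 ≤ (n : ℝ) * ρ := mul_nonneg (Nat.cast_nonneg n) hρ0
    positivity
  have hy1 : ((d : ℝ) + 1) * ((n : ℝ) * ρ) ≤ 1 := (mul_le_mul_of_nonneg_left hnρ (by positivity)).trans (by linarith only [hsmall, show ((d : ℝ) + 1) * (Cρ * r) = ((d : ℝ) + 1) * Cρ * r by ring])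
  have h2 := exp_sub_one_le_two_mul hy0 hy1
  calc (1 + ρ) ^ ((d + 1) * n) - 1 ≤ Real.exp (((d : ℝ) + 1) * ((n : ℝ) * ρ)) - 1 := h1
    _ ≤ 2 * (((d : ℝ) + 1) * ((n : ℝ) * ρ)) := h2
    _ ≤ 2 * (((d : ℝ) + 1) * (Cρ * r)) := by gcongr
    _ = (2 * ((d : ℝ) + 1) * Cρ) * r := by ring

/-! ## §2 The global row for `T = Ad_{e^{A/n}}` at the mass `a = n^{d+1}` -/

/-- THE FIELD-SIZE THRESHOLD of this file: `r ≤ landauExpThreshold` gives `2r ≤ 1`, `(d+1)C_ρr ≤ 1` and n15-c∕217's `landauSmallConst·r ≤ 1`. [folklore] -/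
def landauExpThreshold (D I κm cG cA cD cS P0 c δ : ℝ) : ℝ :=
  1 / (2 + D * (2 * I * κm) + landauSmallConst D I cG cA cD cS P0 (2 * I * κm) (2 * D * (2 * I * κm)) 1 c δ + 1)

/-- ★★★ **THE GLOBAL ROW OF THE LANDAU PERTURBATION LETTER FOR `T = coordMat e Ad_{e^{A/n}}`, `A` SKEW OF SIZE `r`, FROM THE FOUR FLAT ROWS AND THE GRADIENT DIFFERENCE.**
On `Tor (fine n M)` with King's unit blocks, at the mass `a = n^{d+1}`: flat rows `G′(1) ≤ C_Ge^{−δd}`, `G′(1)∂ᵀ ≤ C_Ae^{−δd}`, `∂G′(1) ≤ C_De^{−δd}`, `(Q′G′²Q′ᵀ)⁻¹(1) ≤ C_Sn^{d+1}e^{−δd}`, and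
`D_TG′(T) − ∂G′(1) ≤ P₀re^{−δd}`; then for `0 ≤ r ≤ landauExpThreshold`: `landauCov T n^{d+1} − landauCov 1 n^{d+1} ≤ c_R·r·e^{−(3δ/8)d}` with
`c_R = landauRowConst (d+1) |ι| C_G C_A C_D C_S P₀ C_ρ C_σ 1 c c′ δ`, `C_ρ = 2|ι|κm`, `C_σ = 2(d+1)C_ρ`, `κm = κ_e·2√m·√m`.
[cite: Balaban1985BackgroundPropagators, (3.49) p.399, Thm 3.1 (3.42) p.397, Thm 3.2 (3.48) p.398, Thm 3.4 p.400, (3.35)–(3.37) p.396; Balaban1984PropagatorsII, (2.52)–(2.56) pp.232–233] -/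
theorem hasMaj_landauCov_sub_exp_of_flat {A : Fin (d + 1) → Tor (fine n M) × Fin (d + 1) → Matrix mm mm ℂ} (hAs : ∀ μ p, (A μ p)ᴴ = -A μ p) {r : ℝ} (hr0 : 0 ≤ r) (hA : ∀ μ p, ‖A μ p‖ ≤ r)
    {δ CG CA CD CS P0 : ℝ} (hδ : 0 < δ) (hCG : 0 ≤ CG) (hCA : 0 ≤ CA) (hCD : 0 ≤ CD) (hCS : 0 ≤ CS) (hP0 : 0 ≤ P0)
    (hG1 : HasMaj (BlockNorm.ofBlocks (unitTorusGeo L k M) (liftBlk (blockOf n M) ι)) (BlockNorm.ofBlocks (unitTorusGeo L k M) (liftBlk (blockOf n M) ι)) (Matrix.mulVecLin (cGreen M n (fun (_ : Fin (d + 1)) (_ : Tor (fine n M)) => (1 : Matrix ι ι ℝ)) ((n : ℝ) ^ (d + 1)))) (fun y y' => CG * Real.exp (-(δ * tdistT M y y'))))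
    (hA1 : HasMaj (BlockNorm.ofBlocks (unitTorusGeo L k M) (liftBlk (fun b : Tor (fine n M) × Fin (d + 1) => blockOf n M b.1) ι)) (BlockNorm.ofBlocks (unitTorusGeo L k M) (liftBlk (blockOf n M) ι)) (Matrix.mulVecLin (cGreen M n (fun (_ : Fin (d + 1)) (_ : Tor (fine n M)) => (1 : Matrix ι ι ℝ)) ((n : ℝ) ^ (d + 1)) * (cgrad M n (fun (_ : Fin (d + 1)) (_ : Tor (fine n M)) => (1 : Matrix ι ι ℝ)))ᵀ)) (fun y y' => CA * Real.exp (-(δ * tdistT M y y'))))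
    (hD1 : HasMaj (BlockNorm.ofBlocks (unitTorusGeo L k M) (liftBlk (blockOf n M) ι)) (BlockNorm.ofBlocks (unitTorusGeo L k M) (liftBlk (fun b : Tor (fine n M) × Fin (d + 1) => blockOf n M b.1) ι)) (Matrix.mulVecLin (cgrad M n (fun (_ : Fin (d + 1)) (_ : Tor (fine n M)) => (1 : Matrix ι ι ℝ)) * cGreen M n (fun (_ : Fin (d + 1)) (_ : Tor (fine n M)) => (1 : Matrix ι ι ℝ)) ((n : ℝ) ^ (d + 1)))) (fun y y' => CD * Real.exp (-(δ * tdistT M y y'))))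
    (hS1 : HasMaj (BlockNorm.ofBlocks (unitTorusGeo L k M) (liftBlk (fun y : Tor M => y) ι)) (BlockNorm.ofBlocks (unitTorusGeo L k M) (liftBlk (fun y : Tor M => y) ι)) (Matrix.mulVecLin (cSop M n (fun (_ : Fin (d + 1)) (_ : Tor (fine n M)) => (1 : Matrix ι ι ℝ)) ((n : ℝ) ^ (d + 1)))⁻¹) (fun y y' => CS * (n : ℝ) ^ (d + 1) * Real.exp (-(δ * tdistT M y y'))))
    (hδD : HasMaj (BlockNorm.ofBlocks (unitTorusGeo L k M) (liftBlk (blockOf n M) ι)) (BlockNorm.ofBlocks (unitTorusGeo L k M) (liftBlk (fun b : Tor (fine n M) × Fin (d + 1) => blockOf n M b.1) ι)) (Matrix.mulVecLin (cgrad M n (cvT₀ e (fun μ p => NormedSpace.exp ((((n : ℕ) : ℝ))⁻¹ • A μ p))) * cGreen M n (cvT₀ e (fun μ p => NormedSpace.exp ((((n : ℕ) : ℝ))⁻¹ • A μ p))) ((n : ℝ) ^ (d + 1)) - cgrad M n (fun (_ : Fin (d + 1)) (_ : Tor (fine n M)) => (1 : Matrix ι ι ℝ)) * cGreen M n (fun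 (_ : Fin (d + 1)) (_ : Tor (fine n M)) => (1 : Matrix ι ι ℝ)) ((n : ℝ) ^ (d + 1)))) (fun y y' => P0 * r * Real.exp (-(δ * tdistT M y y'))))
    (hsmall : r ≤ landauExpThreshold ((d : ℝ) + 1) (Fintype.card ι) (@basisConst ι _ (Matrix mm mm ℂ) Matrix.frobeniusNormedAddCommGroup Matrix.frobeniusNormedSpace e * (2 * Real.sqrt (Fintype.card mm)) * Real.sqrt (Fintype.card mm)) CG CA CD CS P0
      (B4Sect5Proof.latticeConst (d + 1) (δ / 16)) δ) :
    HasMaj (BlockNorm.ofBlocks (unitTorusGeo L k M) (liftBlk (fun b : Tor (fine n M) × Fin (d + 1) => blockOf n M b.1) ι)) (BlockNorm.ofBlocks (unitTorusGeo L k M) (liftBlk (fun b : Tor (fine n M) × Fin (d + 1) => blockOf n M b.1) ι)) (Matrix.mulVecLin (landauCov M n (cvT₀ e (fun μ p => NormedSpace.exp ((((n : ℕ) : ℝ))⁻¹ • A μ p))) ((n : ℝ) ^ (d + 1)) - landauCov M n (fun (_ : Fin (d + 1)) (_ : Tor (fine n M)) => (1 : Matrix ι ι ℝ)) ((n : ℝ)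 ^ (d + 1))))
      (fun y y' => landauRowConst ((d : ℝ) + 1) (Fintype.card ι) CG CA CD CS P0 (2 * Fintype.card ι * (@basisConst ι _ (Matrix mm mm ℂ) Matrix.frobeniusNormedAddCommGroup Matrix.frobeniusNormedSpace e * (2 * Real.sqrt (Fintype.card mm)) * Real.sqrt (Fintype.card mm)))
        (2 * ((d : ℝ) + 1) * (2 * Fintype.card ι * (@basisConst ι _ (Matrix mm mm ℂ) Matrix.frobeniusNormedAddCommGroup Matrix.frobeniusNormedSpace e * (2 * Real.sqrt (Fintype.card mm)) * Real.sqrt (Fintype.card mm))))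
        1 (B4Sect5Proof.latticeConst (d + 1) (δ / 16)) (B4Sect5Proof.latticeConst (d + 1) (3 * δ / 4 / 8)) δ * r * Real.exp (-((3 * δ / 8) * tdistT M y y'))) := by
  -- abbreviations (opaque)
  obtain ⟨κm, hκmdef⟩ : ∃ x : ℝ, x = @basisConst ι _ (Matrix mm mm ℂ) Matrix.frobeniusNormedAddCommGroup Matrix.frobeniusNormedSpace e * (2 * Real.sqrt (Fintype.card mm)) * Real.sqrt (Fintype.card mm) := ⟨_, rfl⟩
  have hκm : 0 ≤ κm := by rw [hκmdef]; have := @basisConst_nonneg ι _ (Matrix mm mm ℂ) Matrix.frobeniusNormedAddCommGroup Matrix.frobeniusNormedSpace e; positivity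
  obtain ⟨Cρ, hCρdef⟩ : ∃ x : ℝ, x = 2 * Fintype.card ι * κm := ⟨_, rfl⟩
  have hCρ : 0 ≤ Cρ := by rw [hCρdef]; positivity
  obtain ⟨S, hSdef⟩ : ∃ x : ℝ, x = landauSmallConst ((d : ℝ) + 1) (Fintype.card ι) CG CA CD CS P0 Cρ (2 * ((d : ℝ) + 1) * Cρ) 1 (B4Sect5Proof.latticeConst (d + 1) (δ / 16)) δ := ⟨_, rfl⟩
  have hS : 0 ≤ S := by rw [hSdef]; unfold landauSmallConst CovLandau.cK1 CovLandau.cB0 CovLandau.cM2 CovLandau.cPG0 CovLandau.cA0; have := B4Sect5Proof.latticeConst_nonneg (d + 1) (by positivity : (0:ℝ) ≤ δ / 16); positivity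
  have hthr : landauExpThreshold ((d : ℝ) + 1) (Fintype.card ι) κm CG CA CD CS P0 (B4Sect5Proof.latticeConst (d + 1) (δ / 16)) δ = 1 / (2 + ((d : ℝ) + 1) * Cρ + S + 1) := by
    rw [hSdef, hCρdef]; rfl
  have hsmall' : r ≤ 1 / (2 + ((d : ℝ) + 1) * Cρ + S + 1) := by rw [← hthr, hκmdef]; exact hsmall
  have hden : 0 < 2 + ((d : ℝ) + 1) * Cρ + S + 1 := by positivity
  have hrd : r * (2 + ((d : ℝ) + 1) * Cρ + S + 1) ≤ 1 := by
    have := mul_le_mul_of_nonneg_right hsmall' hden.le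
    rwa [one_div, inv_mul_cancel₀ hden.ne'] at this
  have hDC0 : 0 ≤ ((d : ℝ) + 1) * Cρ := by positivity
  have hr1 : r ≤ 1 := by nlinarith only [hrd, hDC0, hS, hr0]
  have hsm1 : ((d : ℝ) + 1) * Cρ * r ≤ 1 := by nlinarith only [hrd, hDC0, hS, hr0]
  have hsm2 : S * r ≤ 1 := by nlinarith only [hrd, hDC0, hS, hr0]
  -- the datum and its letters
  have hU : ∀ ν (p : Tor (fine n M) × Fin (d + 1)), (NormedSpace.exp ((((n : ℕ) : ℝ))⁻¹ • A ν p))ᴴ * NormedSpace.exp ((((n : ℕ) : ℝ))⁻¹ • A ν p) = 1 :=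
    fun ν p => exp_smul_unitary_of_conjTranspose (hAs ν p) _
  have hT : ∀ ν x, IsUnit ((cvT₀ e (fun μ p => NormedSpace.exp ((((n : ℕ) : ℝ))⁻¹ • A μ p))) ν x) := fun ν x => isUnit_cvT₀ e hU ν x
  obtain ⟨hρr, hρc⟩ := tLetter_rows M n e hAs hA
  have hρ0 : 0 ≤ Fintype.card ι * (@basisConst ι _ (Matrix mm mm ℂ) Matrix.frobeniusNormedAddCommGroup Matrix.frobeniusNormedSpace e * (2 * Real.sqrt (Fintype.card mm)) * (Real.sqrt (Fintype.card mm) * (Real.exp ((((n : ℕ) : ℝ))⁻¹ * r) - 1))) := by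
    have hκ := @basisConst_nonneg ι _ (Matrix mm mm ℂ) Matrix.frobeniusNormedAddCommGroup Matrix.frobeniusNormedSpace e
    have : 0 ≤ Real.exp ((((n : ℕ) : ℝ))⁻¹ * r) - 1 := by have := Real.add_one_le_exp ((((n : ℕ) : ℝ))⁻¹ * r); nlinarith only [this, show 0 ≤ (((n : ℕ) : ℝ))⁻¹ * r by positivity]
    positivity
  have hnρ : (n : ℝ) * (Fintype.card ι * (@basisConst ι _ (Matrix mm mm ℂ) Matrix.frobeniusNormedAddCommGroup Matrix.frobeniusNormedSpace e * (2 * Real.sqrt (Fintype.card mm)) * (Real.sqrt (Fintype.card mm) * (Real.exp ((((n : ℕ) : ℝ))⁻¹ * r) - 1)))) ≤ Cρ * r := by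
    have h := tLetter_nrho (ι := ι) n hκm hr0 hr1
    rw [← hCρdef, hκmdef] at h
    refine le_trans (le_of_eq ?_) h
    ring
  -- the staircase differences
  have e1 : ∀ (y : Tor M) (a' : Fin (d + 1) → Fin n), cvaStair M n (fun μ (b : Tor (fine n M) × Fin (d + 1)) => (fun (_ : Fin (d + 1)) (_ : Tor (fine n M)) => (1 : Matrix ι ι ℝ)) μ b.1) y a' 0 = 1 := fun y a' => cvaStair_one M n y a' 0
  have hσr : ∀ y a' i, ∑ j, |(cvaStair M n (fun μ b => (cvT₀ e (fun μ p => NormedSpace.exp ((((n : ℕ) : ℝ))⁻¹ • A μ p))) μ b.1) y a' 0 - cvaStair M n (fun μ b => (fun (_ : Fin (d + 1)) (_ : Tor (fine n M)) => (1 : Matrix ι ι ℝ)) μ b.1) y a' 0) i j| ≤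
      (1 + Fintype.card ι * (@basisConst ι _ (Matrix mm mm ℂ) Matrix.frobeniusNormedAddCommGroup Matrix.frobeniusNormedSpace e * (2 * Real.sqrt (Fintype.card mm)) * (Real.sqrt (Fintype.card mm) * (Real.exp ((((n : ℕ) : ℝ))⁻¹ * r) - 1)))) ^ ((d + 1) * n) - 1 := by
    intro y a' i
    rw [e1]
    exact rows_cvaStair_sub_one_le M n hρ0 (T := fun μ b => (cvT₀ e (fun μ p => NormedSpace.exp ((((n : ℕ) : ℝ))⁻¹ • A μ p))) μ b.1) (fun μ p i' => hρr μ p.1 i') y a' 0 i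
  have hσc : ∀ y a' j, ∑ i, |(cvaStair M n (fun μ b => (cvT₀ e (fun μ p => NormedSpace.exp ((((n : ℕ) : ℝ))⁻¹ • A μ p))) μ b.1) y a' 0 - cvaStair M n (fun μ b => (fun (_ : Fin (d + 1)) (_ : Tor (fine n M)) => (1 : Matrix ι ι ℝ)) μ b.1) y a' 0) i j| ≤
      (1 + Fintype.card ι * (@basisConst ι _ (Matrix mm mm ℂ) Matrix.frobeniusNormedAddCommGroup Matrix.frobeniusNormedSpace e * (2 * Real.sqrt (Fintype.card mm)) * (Real.sqrt (Fintype.card mm) * (Real.exp ((((n : ℕ) : ℝ))⁻¹ * r) - 1)))) ^ ((d + 1) * n) - 1 := by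
    intro y a' j
    rw [e1]
    exact cols_cvaStair_sub_one_le M n hρ0 (T := fun μ b => (cvT₀ e (fun μ p => NormedSpace.exp ((((n : ℕ) : ℝ))⁻¹ • A μ p))) μ b.1) (fun μ p j' => hρc μ p.1 j') y a' 0 j
  have hσ0 : 0 ≤ (1 + Fintype.card ι * (@basisConst ι _ (Matrix mm mm ℂ) Matrix.frobeniusNormedAddCommGroup Matrix.frobeniusNormedSpace e * (2 * Real.sqrt (Fintype.card mm)) * (Real.sqrt (Fintype.card mm) * (Real.exp ((((n : ℕ) : ℝ))⁻¹ * r) - 1)))) ^ ((d + 1) * n) - 1 := by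
    have := one_le_pow₀ (M₀ := ℝ) (a := 1 + Fintype.card ι * (@basisConst ι _ (Matrix mm mm ℂ) Matrix.frobeniusNormedAddCommGroup Matrix.frobeniusNormedSpace e * (2 * Real.sqrt (Fintype.card mm)) * (Real.sqrt (Fintype.card mm) * (Real.exp ((((n : ℕ) : ℝ))⁻¹ * r) - 1)))) (by linarith only [hρ0]) (n := (d + 1) * n)
    linarith only [this]
  have hσle := tLetter_sigma (d := d) n hρ0 hnρ hsm1
  -- n15-c∕217
  have hn : (0 : ℝ) < (n : ℝ) ^ (d + 1) := pow_pos (Nat.cast_pos.mpr (Nat.pos_of_ne_zero (NeZero.ne n))) _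
  have haα : |((n : ℝ) ^ (d + 1))| * ((n : ℝ) ^ (d + 1))⁻¹ ≤ 1 := by rw [abs_of_pos hn, mul_inv_cancel₀ hn.ne']
  have hsm3 : landauSmallConst ((d : ℝ) + 1) (Fintype.card ι) CG CA CD CS P0 Cρ (2 * ((d : ℝ) + 1) * Cρ) 1 (B4Sect5Proof.latticeConst (d + 1) (δ / 16)) δ * r ≤ 1 := by rw [← hSdef]; exact hsm2
  have key := hasMaj_landauCov_sub_of_flat M n L k hT hn hδ hCG hCA hCD hCS hP0 hCρ (by positivity : 0 ≤ 2 * ((d : ℝ) + 1) * Cρ) zero_le_one hr0 hr1 hρ0 hσ0 haα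
    hρr hρc hσr hσc hnρ hσle hG1 hA1 hD1 hS1 hδD hsm3
  rw [hCρdef, hκmdef] at key
  exact key

/-- ★★★ (v1.1, MASS WINDOW) **THE SAME AT ANY MASS `a = a_w·n^{d+1}` WITH `0 < a_w ≤ 1`** — the form in which the King-model rung (`fineOp n M a_w n² 0`, `a_w = a_K ∈ [a(1−L⁻²), a]`)
and [Balaban1984PropagatorsII] (2.3) («a(L^kη)^{−2}Q*Q», `a = O(1)`) state the flat rows.  **THE GLOBAL ROW OF THE LANDAU PERTURBATION LETTER FOR `T = coordMat e Ad_{e^{A/n}}`, `A` SKEW OF SIZE `r`, FROM THE FOUR FLAT ROWS AND THE GRADIENT DIFFERENCE.**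
On `Tor (fine n M)` with King's unit blocks, at the mass `a = n^{d+1}`: flat rows `G′(1) ≤ C_Ge^{−δd}`, `G′(1)∂ᵀ ≤ C_Ae^{−δd}`, `∂G′(1) ≤ C_De^{−δd}`, `(Q′G′²Q′ᵀ)⁻¹(1) ≤ C_Sn^{d+1}e^{−δd}`, and
`D_TG′(T) − ∂G′(1) ≤ P₀re^{−δd}`; then for `0 ≤ r ≤ landauExpThreshold`: `landauCov T n^{d+1} − landauCov 1 n^{d+1} ≤ c_R·r·e^{−(3δ/8)d}` with
`c_R = landauRowConst (d+1) |ι| C_G C_A C_D C_S P₀ C_ρ C_σ 1 c c′ δ`, `C_ρ = 2|ι|κm`, `C_σ = 2(d+1)C_ρ`, `κm = κ_e·2√m·√m`.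
[cite: Balaban1985BackgroundPropagators, (3.49) p.399, Thm 3.1 (3.42) p.397, Thm 3.2 (3.48) p.398, Thm 3.4 p.400, (3.35)–(3.37) p.396; Balaban1984PropagatorsII, (2.52)–(2.56) pp.232–233] -/
theorem hasMaj_landauCov_sub_exp_of_flat_mass {aw : ℝ} (haw0 : 0 < aw) (haw1 : aw ≤ 1) {A : Fin (d + 1) → Tor (fine n M) × Fin (d + 1) → Matrix mm mm ℂ} (hAs : ∀ μ p, (A μ p)ᴴ = -A μ p) {r : ℝ} (hr0 : 0 ≤ r) (hA : ∀ μ p, ‖A μ p‖ ≤ r)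
    {δ CG CA CD CS P0 : ℝ} (hδ : 0 < δ) (hCG : 0 ≤ CG) (hCA : 0 ≤ CA) (hCD : 0 ≤ CD) (hCS : 0 ≤ CS) (hP0 : 0 ≤ P0)
    (hG1 : HasMaj (BlockNorm.ofBlocks (unitTorusGeo L k M) (liftBlk (blockOf n M) ι)) (BlockNorm.ofBlocks (unitTorusGeo L k M) (liftBlk (blockOf n M) ι)) (Matrix.mulVecLin (cGreen M n (fun (_ : Fin (d + 1)) (_ : Tor (fine n M)) => (1 : Matrix ι ι ℝ)) (aw * (n : ℝ) ^ (d + 1)))) (fun y y' => CG * Real.exp (-(δ * tdistT M y y'))))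
    (hA1 : HasMaj (BlockNorm.ofBlocks (unitTorusGeo L k M) (liftBlk (fun b : Tor (fine n M) × Fin (d + 1) => blockOf n M b.1) ι)) (BlockNorm.ofBlocks (unitTorusGeo L k M) (liftBlk (blockOf n M) ι)) (Matrix.mulVecLin (cGreen M n (fun (_ : Fin (d + 1)) (_ : Tor (fine n M)) => (1 : Matrix ι ι ℝ)) (aw * (n : ℝ) ^ (d + 1)) * (cgrad M n (fun (_ : Fin (d + 1)) (_ : Tor (fine n M)) => (1 : Matrix ι ι ℝ)))ᵀ)) (fun y y' => CA * Real.exp (-(δ * tdistT M y y'))))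
    (hD1 : HasMaj (BlockNorm.ofBlocks (unitTorusGeo L k M) (liftBlk (blockOf n M) ι)) (BlockNorm.ofBlocks (unitTorusGeo L k M) (liftBlk (fun b : Tor (fine n M) × Fin (d + 1) => blockOf n M b.1) ι)) (Matrix.mulVecLin (cgrad M n (fun (_ : Fin (d + 1)) (_ : Tor (fine n M)) => (1 : Matrix ι ι ℝ)) * cGreen M n (fun (_ : Fin (d + 1)) (_ : Tor (fine n M)) => (1 : Matrix ι ι ℝ)) (aw * (n : ℝ) ^ (d + 1)))) (fun y y' => CD * Real.exp (-(δ * tdistT M y y'))))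
    (hS1 : HasMaj (BlockNorm.ofBlocks (unitTorusGeo L k M) (liftBlk (fun y : Tor M => y) ι)) (BlockNorm.ofBlocks (unitTorusGeo L k M) (liftBlk (fun y : Tor M => y) ι)) (Matrix.mulVecLin (cSop M n (fun (_ : Fin (d + 1)) (_ : Tor (fine n M)) => (1 : Matrix ι ι ℝ)) (aw * (n : ℝ) ^ (d + 1)))⁻¹) (fun y y' => CS * (n : ℝ) ^ (d + 1) * Real.exp (-(δ * tdistT M y y'))))
    (hδD : HasMaj (BlockNorm.ofBlocks (unitTorusGeo L k M) (liftBlk (blockOf n M) ι)) (BlockNorm.ofBlocks (unitTorusGeo L k M) (liftBlk (fun b : Tor (fine n M) × Fin (d + 1) => blockOf n M b.1) ι)) (Matrix.mulVecLin (cgrad M n (cvT₀ e (fun μ p => NormedSpace.exp ((((n : ℕ) : ℝ))⁻¹ • A μ p))) * cGreen M n (cvT₀ e (fun μ p => NormedSpace.exp ((((n : ℕ) : ℝ))⁻¹ • A μ p))) (aw * (n : ℝ) ^ (d + 1)) - cgrad M n (fun (_ : Fin (d + 1)) (_ : Tor (fine n M)) => (1 : Matrix ι ι ℝ)) * cGreen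 M n (fun (_ : Fin (d + 1)) (_ : Tor (fine n M)) => (1 : Matrix ι ι ℝ)) (aw * (n : ℝ) ^ (d + 1)))) (fun y y' => P0 * r * Real.exp (-(δ * tdistT M y y'))))
    (hsmall : r ≤ landauExpThreshold ((d : ℝ) + 1) (Fintype.card ι) (@basisConst ι _ (Matrix mm mm ℂ) Matrix.frobeniusNormedAddCommGroup Matrix.frobeniusNormedSpace e * (2 * Real.sqrt (Fintype.card mm)) * Real.sqrt (Fintype.card mm)) CG CA CD CS P0
      (B4Sect5Proof.latticeConst (d + 1) (δ / 16)) δ) :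
    HasMaj (BlockNorm.ofBlocks (unitTorusGeo L k M) (liftBlk (fun b : Tor (fine n M) × Fin (d + 1) => blockOf n M b.1) ι)) (BlockNorm.ofBlocks (unitTorusGeo L k M) (liftBlk (fun b : Tor (fine n M) × Fin (d + 1) => blockOf n M b.1) ι)) (Matrix.mulVecLin (landauCov M n (cvT₀ e (fun μ p => NormedSpace.exp ((((n : ℕ) : ℝ))⁻¹ • A μ p))) (aw * (n : ℝ) ^ (d + 1)) - landauCov M n (fun (_ : Fin (d + 1)) (_ : Tor (fine n M)) => (1 : Matrix ι ι ℝ)) (aw * (n : ℝ) ^ (d + 1))))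
      (fun y y' => landauRowConst ((d : ℝ) + 1) (Fintype.card ι) CG CA CD CS P0 (2 * Fintype.card ι * (@basisConst ι _ (Matrix mm mm ℂ) Matrix.frobeniusNormedAddCommGroup Matrix.frobeniusNormedSpace e * (2 * Real.sqrt (Fintype.card mm)) * Real.sqrt (Fintype.card mm)))
        (2 * ((d : ℝ) + 1) * (2 * Fintype.card ι * (@basisConst ι _ (Matrix mm mm ℂ) Matrix.frobeniusNormedAddCommGroup Matrix.frobeniusNormedSpace e * (2 * Real.sqrt (Fintype.card mm)) * Real.sqrt (Fintype.card mm))))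
        1 (B4Sect5Proof.latticeConst (d + 1) (δ / 16)) (B4Sect5Proof.latticeConst (d + 1) (3 * δ / 4 / 8)) δ * r * Real.exp (-((3 * δ / 8) * tdistT M y y'))) := by
  -- abbreviations (opaque)
  obtain ⟨κm, hκmdef⟩ : ∃ x : ℝ, x = @basisConst ι _ (Matrix mm mm ℂ) Matrix.frobeniusNormedAddCommGroup Matrix.frobeniusNormedSpace e * (2 * Real.sqrt (Fintype.card mm)) * Real.sqrt (Fintype.card mm) := ⟨_, rfl⟩
  have hκm : 0 ≤ κm := by rw [hκmdef]; have := @basisConst_nonneg ι _ (Matrix mm mm ℂ) Matrix.frobeniusNormedAddCommGroup Matrix.frobeniusNormedSpace e; positivity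
  obtain ⟨Cρ, hCρdef⟩ : ∃ x : ℝ, x = 2 * Fintype.card ι * κm := ⟨_, rfl⟩
  have hCρ : 0 ≤ Cρ := by rw [hCρdef]; positivity
  obtain ⟨S, hSdef⟩ : ∃ x : ℝ, x = landauSmallConst ((d : ℝ) + 1) (Fintype.card ι) CG CA CD CS P0 Cρ (2 * ((d : ℝ) + 1) * Cρ) 1 (B4Sect5Proof.latticeConst (d + 1) (δ / 16)) δ := ⟨_, rfl⟩
  have hS : 0 ≤ S := by rw [hSdef]; unfold landauSmallConst CovLandau.cK1 CovLandau.cB0 CovLandau.cM2 CovLandau.cPG0 CovLandau.cA0; have := B4Sect5Proof.latticeConst_nonneg (d + 1) (by positivity : (0:ℝ) ≤ δ / 16); positivity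
  have hthr : landauExpThreshold ((d : ℝ) + 1) (Fintype.card ι) κm CG CA CD CS P0 (B4Sect5Proof.latticeConst (d + 1) (δ / 16)) δ = 1 / (2 + ((d : ℝ) + 1) * Cρ + S + 1) := by
    rw [hSdef, hCρdef]; rfl
  have hsmall' : r ≤ 1 / (2 + ((d : ℝ) + 1) * Cρ + S + 1) := by rw [← hthr, hκmdef]; exact hsmall
  have hden : 0 < 2 + ((d : ℝ) + 1) * Cρ + S + 1 := by positivity
  have hrd : r * (2 + ((d : ℝ) + 1) * Cρ + S + 1) ≤ 1 := by
    have := mul_le_mul_of_nonneg_right hsmall' hden.le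
    rwa [one_div, inv_mul_cancel₀ hden.ne'] at this
  have hDC0 : 0 ≤ ((d : ℝ) + 1) * Cρ := by positivity
  have hr1 : r ≤ 1 := by nlinarith only [hrd, hDC0, hS, hr0]
  have hsm1 : ((d : ℝ) + 1) * Cρ * r ≤ 1 := by nlinarith only [hrd, hDC0, hS, hr0]
  have hsm2 : S * r ≤ 1 := by nlinarith only [hrd, hDC0, hS, hr0]
  -- the datum and its letters
  have hU : ∀ ν (p : Tor (fine n M) × Fin (d + 1)), (NormedSpace.exp ((((n : ℕ) : ℝ))⁻¹ • A ν p))ᴴ * NormedSpace.exp ((((n : ℕ) : ℝ))⁻¹ • A ν p) = 1 :=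
    fun ν p => exp_smul_unitary_of_conjTranspose (hAs ν p) _
  have hT : ∀ ν x, IsUnit ((cvT₀ e (fun μ p => NormedSpace.exp ((((n : ℕ) : ℝ))⁻¹ • A μ p))) ν x) := fun ν x => isUnit_cvT₀ e hU ν x
  obtain ⟨hρr, hρc⟩ := tLetter_rows M n e hAs hA
  have hρ0 : 0 ≤ Fintype.card ι * (@basisConst ι _ (Matrix mm mm ℂ) Matrix.frobeniusNormedAddCommGroup Matrix.frobeniusNormedSpace e * (2 * Real.sqrt (Fintype.card mm)) * (Real.sqrt (Fintype.card mm) * (Real.exp ((((n : ℕ) : ℝ))⁻¹ * r) - 1))) := by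
    have hκ := @basisConst_nonneg ι _ (Matrix mm mm ℂ) Matrix.frobeniusNormedAddCommGroup Matrix.frobeniusNormedSpace e
    have : 0 ≤ Real.exp ((((n : ℕ) : ℝ))⁻¹ * r) - 1 := by have := Real.add_one_le_exp ((((n : ℕ) : ℝ))⁻¹ * r); nlinarith only [this, show 0 ≤ (((n : ℕ) : ℝ))⁻¹ * r by positivity]
    positivity
  have hnρ : (n : ℝ) * (Fintype.card ι * (@basisConst ι _ (Matrix mm mm ℂ) Matrix.frobeniusNormedAddCommGroup Matrix.frobeniusNormedSpace e * (2 * Real.sqrt (Fintype.card mm)) * (Real.sqrt (Fintype.card mm) * (Real.exp ((((n : ℕ) : ℝ))⁻¹ * r) - 1)))) ≤ Cρ * r := by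
    have h := tLetter_nrho (ι := ι) n hκm hr0 hr1
    rw [← hCρdef, hκmdef] at h
    refine le_trans (le_of_eq ?_) h
    ring
  -- the staircase differences
  have e1 : ∀ (y : Tor M) (a' : Fin (d + 1) → Fin n), cvaStair M n (fun μ (b : Tor (fine n M) × Fin (d + 1)) => (fun (_ : Fin (d + 1)) (_ : Tor (fine n M)) => (1 : Matrix ι ι ℝ)) μ b.1) y a' 0 = 1 := fun y a' => cvaStair_one M n y a' 0
  have hσr : ∀ y a' i, ∑ j, |(cvaStair M n (fun μ b => (cvT₀ e (fun μ p => NormedSpace.exp ((((n : ℕ) : ℝ))⁻¹ • A μ p))) μ b.1) y a' 0 - cvaStair M n (fun μ b => (fun (_ : Fin (d + 1)) (_ : Tor (fine n M)) => (1 : Matrix ι ι ℝ)) μ b.1) y a' 0) i j| ≤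
      (1 + Fintype.card ι * (@basisConst ι _ (Matrix mm mm ℂ) Matrix.frobeniusNormedAddCommGroup Matrix.frobeniusNormedSpace e * (2 * Real.sqrt (Fintype.card mm)) * (Real.sqrt (Fintype.card mm) * (Real.exp ((((n : ℕ) : ℝ))⁻¹ * r) - 1)))) ^ ((d + 1) * n) - 1 := by
    intro y a' i
    rw [e1]
    exact rows_cvaStair_sub_one_le M n hρ0 (T := fun μ b => (cvT₀ e (fun μ p => NormedSpace.exp ((((n : ℕ) : ℝ))⁻¹ • A μ p))) μ b.1) (fun μ p i' => hρr μ p.1 i') y a' 0 i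
  have hσc : ∀ y a' j, ∑ i, |(cvaStair M n (fun μ b => (cvT₀ e (fun μ p => NormedSpace.exp ((((n : ℕ) : ℝ))⁻¹ • A μ p))) μ b.1) y a' 0 - cvaStair M n (fun μ b => (fun (_ : Fin (d + 1)) (_ : Tor (fine n M)) => (1 : Matrix ι ι ℝ)) μ b.1) y a' 0) i j| ≤
      (1 + Fintype.card ι * (@basisConst ι _ (Matrix mm mm ℂ) Matrix.frobeniusNormedAddCommGroup Matrix.frobeniusNormedSpace e * (2 * Real.sqrt (Fintype.card mm)) * (Real.sqrt (Fintype.card mm) * (Real.exp ((((n : ℕ) : ℝ))⁻¹ * r) - 1)))) ^ ((d + 1) * n) - 1 := by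
    intro y a' j
    rw [e1]
    exact cols_cvaStair_sub_one_le M n hρ0 (T := fun μ b => (cvT₀ e (fun μ p => NormedSpace.exp ((((n : ℕ) : ℝ))⁻¹ • A μ p))) μ b.1) (fun μ p j' => hρc μ p.1 j') y a' 0 j
  have hσ0 : 0 ≤ (1 + Fintype.card ι * (@basisConst ι _ (Matrix mm mm ℂ) Matrix.frobeniusNormedAddCommGroup Matrix.frobeniusNormedSpace e * (2 * Real.sqrt (Fintype.card mm)) * (Real.sqrt (Fintype.card mm) * (Real.exp ((((n : ℕ) : ℝ))⁻¹ * r) - 1)))) ^ ((d + 1) * n) - 1 := by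
    have := one_le_pow₀ (M₀ := ℝ) (a := 1 + Fintype.card ι * (@basisConst ι _ (Matrix mm mm ℂ) Matrix.frobeniusNormedAddCommGroup Matrix.frobeniusNormedSpace e * (2 * Real.sqrt (Fintype.card mm)) * (Real.sqrt (Fintype.card mm) * (Real.exp ((((n : ℕ) : ℝ))⁻¹ * r) - 1)))) (by linarith only [hρ0]) (n := (d + 1) * n)
    linarith only [this]
  have hσle := tLetter_sigma (d := d) n hρ0 hnρ hsm1
  -- n15-c∕217
  have hn : (0 : ℝ) < (n : ℝ) ^ (d + 1) := pow_pos (Nat.cast_pos.mpr (Nat.pos_of_ne_zero (NeZero.ne n))) _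
  have hna : (0 : ℝ) < aw * (n : ℝ) ^ (d + 1) := mul_pos haw0 hn
  have haα : |(aw * (n : ℝ) ^ (d + 1))| * ((n : ℝ) ^ (d + 1))⁻¹ ≤ 1 := by
    rw [abs_of_pos hna, mul_assoc, mul_inv_cancel₀ hn.ne', mul_one]; exact haw1
  have hsm3 : landauSmallConst ((d : ℝ) + 1) (Fintype.card ι) CG CA CD CS P0 Cρ (2 * ((d : ℝ) + 1) * Cρ) 1 (B4Sect5Proof.latticeConst (d + 1) (δ / 16)) δ * r ≤ 1 := by rw [← hSdef]; exact hsm2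
  have key := hasMaj_landauCov_sub_of_flat M n L k hT hna hδ hCG hCA hCD hCS hP0 hCρ (by positivity : 0 ≤ 2 * ((d : ℝ) + 1) * Cρ) zero_le_one hr0 hr1 hρ0 hσ0 haα
    hρr hρc hσr hσc hnρ hσle hG1 hA1 hD1 hS1 hδD hsm3
  rw [hCρdef, hκmdef] at key
  exact key

end Exp

end Summit.QuantumFields.YangMills.BalabanUVNodes.N15.Gluing

end
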